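import Summits.AnomalousDissipation.AnomalousDissipation.Theorems.BaireTransferRobustLoudUpgradeSmallDataCensus
import Literature.Analysis.FunctionSpaces.TorusClassicalNSUniqueness
import Literature.Analysis.FluidPDE.LinearizedNSTorus

/-!
# Stub `stub_periodicIsSteady` of the line `malkin-cone-group-orbits` (companion c1)
# (crux stmt-AnomalousDissipation-1144, `BaireTransfer.RobustLoudUpgrade`)

PERIODIC SOLUTIONS NEAR THE LAMINAR REGIME ARE STEADY: there is a universal `κ > 0` such that a
`τ`-periodic classical solution `u` of `NS_ν(f)` on `ℝ × T³` and a classical steady state `v` of the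
same system with the same spatial mean (`∫ u(t) = ∫ v` for all `t`) and small enstrophy
`‖∇v‖₂ ≤ κ ν` coincide.  This is the decaying twin of the uniqueness energy argument of
`Literature/Analysis/FunctionSpaces/TorusClassicalNSUniqueness.lean`
(`IsClassicalNSSolutionOn.energy_deriv_sub_le`, `….integral_norm_sub_sq_le_mul_exp`), whose proofs
are copied and adapted: for `w = u - v`, `E(t) = ∫‖w(t)‖²` has the one-sided derivative
`E' = 2ν∫⟪Δw, w⟫ - 2∫⟪(w·∇)v, w⟫` (transport and pressure terms vanish), and now
`∫⟪Δw, w⟫ = -‖∇w‖₂²`, `∫⟪(w·∇)v, w⟫ = -∫⟪(w·∇)w, v⟫` is bounded by the trilinear estimate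
`C‖∇w‖₂²‖∇v‖₂` (`SmallData.exists_abs_trilinear_le`, `w(t)` has zero mean), so with `C‖∇v‖₂ ≤ ν/2`
and Poincaré (`4π²∫‖w‖² ≤ ‖∇w‖₂²`) one gets `E' ≤ -ν‖∇w‖₂² ≤ -4π²ν E`.  Grönwall with the negative
rate and periodicity `E(t + τ) = E(t)` give `E(t)(1 - e^{-4π²ντ}) ≤ 0`, hence `E(t) = 0`, `u(t) = v`.

References: J. Serrin, *On the stability of viscous fluid motions*, Arch. Rational Mech. Anal. 3
(1959); R. Temam, *Navier–Stokes Equations* (1979), Ch. III §3.4 (uniqueness and stability of small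
steady flows); A. J. Majda, A. L. Bertozzi, *Vorticity and Incompressible Flow* (2002), Prop. 3.1 /
Cor. 3.1 (the basic energy estimate); patterns from
`Literature/Analysis/FunctionSpaces/TorusClassicalNSUniqueness.lean` and
`Theorems/BaireTransferRobustLoudUpgradeSmallDataCensus.lean`.
-/

-- `Summit.<Summit>.<Problem>` is the tree's mandated summit-side namespace (CONVENTIONS §2); for this
-- single-conjunct summit the two coincide, so the duplicate is deliberate.
set_option linter.dupNamespace false

noncomputable section

open scoped BigOperators Topology InnerProductSpace
open Filter Set Function TopologicalSpace MeasureTheory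

namespace Summit.AnomalousDissipation.AnomalousDissipation.Theorems.RobustLoudUpgrade.LaminarCorner

open Literature.Analysis.FunctionSpaces Literature.Analysis.FunctionSpaces.Torus
open Literature.Analysis.FluidPDE
open Summit.AnomalousDissipation.AnomalousDissipation.Theorems.RobustLoudUpgrade

/-! ## §1 The decaying energy inequality for the difference of two classical solutions -/

section Energy

variable {a b ν C : ℝ} {f u₁ u₂ : ℝ → UnitAddTorus (Fin 3) → EuclideanSpace ℝ (Fin 3)}
  {p₁ p₂ : ℝ → UnitAddTorus (Fin 3) → ℝ}

/-- **Decaying energy inequality.** Let `(u₁, p₁)`, `(u₂, p₂)` be classical solutions of `NS_ν(f)` on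
`[a, b] × T³` (`a < b`, `ν ≥ 0`) whose difference `w = u₁ - u₂` has zero spatial mean at all times,
and let `C` be a trilinear constant (`|∫⟪(a·∇)a, b⟫| ≤ C‖∇a‖₂²‖∇b‖₂` for smooth divergence-free
mean-zero `a`) with `C‖∇u₂(t)‖₂ ≤ ν/2` on `[a, b]`.  Then `E(t) = ∫⟪w, w⟫` has the one-sided
derivative `E' = 2ν∫⟪Δw, w⟫ - 2∫⟪(w·∇)u₂, w⟫` within `[a, b]` and `E' ≤ -4π²ν E`
(`∫⟪Δw, w⟫ = -‖∇w‖₂²`, antisymmetry `∫⟪(w·∇)u₂, w⟫ = -∫⟪u₂, (w·∇)w⟫`, the trilinear bound, and the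
Poincaré inequality `4π²∫‖w‖² ≤ ‖∇w‖₂²`).  The first half is verbatim the proof of
`Torus.IsClassicalNSSolutionOn.energy_deriv_sub_le` (Majda–Bertozzi 2002, Prop. 3.1; Temam 1979,
Ch. III §3.4). [folklore] -/
theorem energy_deriv_sub_le_neg (hν : 0 ≤ ν)
    (hC : ∀ u w : UnitAddTorus (Fin 3) → EuclideanSpace ℝ (Fin 3), IsSmooth u → IsDivFree u →
      HasZeroMean u → IsSmooth w →
        |∫ x, ⟪convect u u x, w x⟫_ℝ| ≤ C * gradNormSq u * Real.sqrt (gradNormSq w))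
    (h₁ : IsClassicalNSSolutionOn (Icc a b) ν f u₁ p₁)
    (h₂ : IsClassicalNSSolutionOn (Icc a b) ν f u₂ p₂) (hab : a < b)
    (h0 : ∀ t ∈ Icc a b, HasZeroMean (fun y => u₁ t y - u₂ t y))
    (hsm : ∀ t ∈ Icc a b, C * Real.sqrt (gradNormSq (u₂ t)) ≤ ν / 2) {t : ℝ} (ht : t ∈ Icc a b) :
    HasDerivWithinAt (fun s => ∫ x, ⟪u₁ s x - u₂ s x, u₁ s x - u₂ s x⟫_ℝ)
        (∫ x, Torus.timeDerivWithin (Icc a b)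
          (fun s y => ⟪u₁ s y - u₂ s y, u₁ s y - u₂ s y⟫_ℝ) t x) (Icc a b) t ∧
      ∫ x, Torus.timeDerivWithin (Icc a b) (fun s y => ⟪u₁ s y - u₂ s y, u₁ s y - u₂ s y⟫_ℝ) t x ≤
        -(4 * Real.pi ^ 2 * ν) * ∫ x, ⟪u₁ t x - u₂ t x, u₁ t x - u₂ t x⟫_ℝ := by
  -- adapted from Literature/Analysis/FunctionSpaces/TorusClassicalNSUniqueness.lean
  -- (`IsClassicalNSSolutionOn.energy_deriv_sub_le`)
  classical
  have hU : UniqueDiffOn ℝ (Icc a b) := uniqueDiffOn_Icc hab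
  set w : ℝ → UnitAddTorus (Fin 3) → EuclideanSpace ℝ (Fin 3) := fun s y => u₁ s y - u₂ s y
    with hw_def
  have hw : IsSmoothSpaceTimeOn (Icc a b) w := h₁.smooth_velocity.sub h₂.smooth_velocity
  refine ⟨(hw.inner hw).hasDerivWithinAt_integral (convex_Icc a b) ht, ?_⟩
  have hwt : IsSmooth (w t) := hw.isSmooth_slice ht
  have hu₁t : IsSmooth (u₁ t) := h₁.smooth_velocity.isSmooth_slice ht
  have hu₂t : IsSmooth (u₂ t) := h₂.smooth_velocity.isSmooth_slice ht
  have hqt : IsSmooth (fun y => p₁ t y - p₂ t y) :=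
    (h₁.smooth_pressure.isSmooth_slice ht).sub (h₂.smooth_pressure.isSmooth_slice ht)
  have hdivw : IsDivFree (w t) := by
    intro x
    have hw' : w t = u₁ t - u₂ t := rfl
    rw [hw', divergence_sub (hu₁t.isContDiff (by simp)) (hu₂t.isContDiff (by simp)),
      h₁.divFree t ht x, h₂.divFree t ht x, sub_zero]
  have hlapw : ∀ x, laplacian (u₁ t) x - laplacian (u₂ t) x = laplacian (w t) x := by
    intro x
    have hw' : w t = u₁ t - u₂ t := rfl
    rw [hw', laplacian_sub hu₁t hu₂t, Pi.sub_apply]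
  -- `∂ₜ⟪w, w⟫ = 2⟪∂ₜw, w⟫` and the equation for `∂ₜw`
  have hpt : ∀ x, Torus.timeDerivWithin (Icc a b) (fun s y => ⟪w s y, w s y⟫_ℝ) t x =
      2 * ⟪Torus.timeDerivWithin (Icc a b) w t x, w t x⟫_ℝ := by
    intro x
    rw [hw.timeDerivWithin_inner hw hU ht x, real_inner_comm (w t x)]
    ring
  have hderiv : ∀ x, Torus.timeDerivWithin (Icc a b) w t x =
      ν • laplacian (w t) x - (convect (u₁ t) (w t) x + convect (w t) (u₂ t) x) -
        gradient (fun y => p₁ t y - p₂ t y) x := by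
    intro x
    rw [← hlapw x]
    exact h₁.timeDerivWithin_sub_eq h₂ hab ht x
  -- the integrals of the four terms
  have hi0 : Integrable (fun x => ⟪laplacian (w t) x, w t x⟫_ℝ) volume :=
    (hwt.laplacian.inner hwt).integrable
  have hi1 : Integrable (fun x => ⟪convect (u₁ t) (w t) x, w t x⟫_ℝ) volume :=
    ((hu₁t.convect hwt).inner hwt).integrable
  have hi2 : Integrable (fun x => ⟪convect (w t) (u₂ t) x, w t x⟫_ℝ) volume :=
    ((hwt.convect hu₂t).inner hwt).integrable
  have hi3 : Integrable (fun x => ⟪gradient (fun y => p₁ t y - p₂ t y) x, w t x⟫_ℝ) volume :=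
    (hqt.gradient.inner hwt).integrable
  have hE't : ∫ x, Torus.timeDerivWithin (Icc a b) (fun s y => ⟪w s y, w s y⟫_ℝ) t x =
      2 * (ν * ∫ x, ⟪laplacian (w t) x, w t x⟫_ℝ) -
        2 * ∫ x, ⟪convect (w t) (u₂ t) x, w t x⟫_ℝ := by
    have hi12 : Integrable (fun x => ⟪convect (u₁ t) (w t) x, w t x⟫_ℝ +
        ⟪convect (w t) (u₂ t) x, w t x⟫_ℝ) volume := hi1.add hi2
    have hiν : Integrable (fun x => ν * ⟪laplacian (w t) x, w t x⟫_ℝ) volume := hi0.const_mul ν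
    have hiF : Integrable (fun x => ν * ⟪laplacian (w t) x, w t x⟫_ℝ -
        (⟪convect (u₁ t) (w t) x, w t x⟫_ℝ + ⟪convect (w t) (u₂ t) x, w t x⟫_ℝ)) volume :=
      hiν.sub hi12
    simp_rw [hpt, hderiv, inner_sub_left, inner_add_left, real_inner_smul_left]
    rw [integral_const_mul, integral_sub hiF hi3, integral_sub hiν hi12, integral_const_mul,
      integral_add hi1 hi2, integral_inner_convect_self_right_eq_zero hu₁t (h₁.divFree t ht) hwt,
      integral_inner_gradient_eq_zero_of_isDivFree hwt hqt hdivw]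
    ring
  -- the viscous term: `∫⟪Δw, w⟫ = -‖∇w‖₂²`
  have hvisc : ∫ x, ⟪laplacian (w t) x, w t x⟫_ℝ = -gradNormSq (w t) := by
    rw [← SmallData.integral_inner_laplacian_self hwt]
    exact integral_congr_ae (ae_of_all _ fun x => real_inner_comm _ _)
  -- the stretching term: `∫⟪(w·∇)u₂, w⟫ = -∫⟪u₂, (w·∇)w⟫`, bounded by the trilinear estimate
  have hstr : |∫ x, ⟪convect (w t) (u₂ t) x, w t x⟫_ℝ| ≤
      C * gradNormSq (w t) * Real.sqrt (gradNormSq (u₂ t)) := by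
    rw [integral_inner_convect_eq_neg hwt hdivw hu₂t hwt, abs_neg]
    have hcomm : ∫ x, ⟪u₂ t x, convect (w t) (w t) x⟫_ℝ = ∫ x, ⟪convect (w t) (w t) x, u₂ t x⟫_ℝ :=
      integral_congr_ae (ae_of_all _ fun x => real_inner_comm _ _)
    rw [hcomm]
    exact hC (w t) (u₂ t) hwt hdivw (h0 t ht) hu₂t
  -- Poincaré for the mean-zero `w t`
  have hP : 4 * Real.pi ^ 2 * ∫ x, ‖w t x‖ ^ 2 ≤ gradNormSq (w t) :=
    Torus.integral_norm_sq_le_gradNormSq_of_hasZeroMean hwt (h0 t ht)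
  have hG0 : 0 ≤ gradNormSq (w t) := gradNormSq_nonneg (w t)
  have hCG : C * gradNormSq (w t) * Real.sqrt (gradNormSq (u₂ t)) ≤ gradNormSq (w t) * (ν / 2) :=
    calc C * gradNormSq (w t) * Real.sqrt (gradNormSq (u₂ t))
        = gradNormSq (w t) * (C * Real.sqrt (gradNormSq (u₂ t))) := by ring
      _ ≤ gradNormSq (w t) * (ν / 2) := mul_le_mul_of_nonneg_left (hsm t ht) hG0
  have hνP : ν * (4 * Real.pi ^ 2 * ∫ x, ‖w t x‖ ^ 2) ≤ ν * gradNormSq (w t) :=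
    mul_le_mul_of_nonneg_left hP hν
  have hE_eq : ∫ x, ⟪u₁ t x - u₂ t x, u₁ t x - u₂ t x⟫_ℝ = ∫ x, ‖w t x‖ ^ 2 :=
    integral_congr_ae (ae_of_all _ fun x => real_inner_self_eq_norm_sq _)
  have hE'_eq : ∫ x, Torus.timeDerivWithin (Icc a b) (fun s y => ⟪u₁ s y - u₂ s y, u₁ s y - u₂ s y⟫_ℝ) t x
      = ∫ x, Torus.timeDerivWithin (Icc a b) (fun s y => ⟪w s y, w s y⟫_ℝ) t x := rfl
  rw [hE'_eq, hE_eq, hE't, hvisc]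
  have h4 := (abs_le.1 hstr).1
  nlinarith [h4, hCG, hνP]

/-- **Exponential `L²` decay of the difference (Grönwall with a negative rate).** Under the
hypotheses of `energy_deriv_sub_le_neg`,
`∫‖u₁(t) - u₂(t)‖² ≤ (∫‖u₁(a) - u₂(a)‖²) · exp(-4π²ν (t - a))` for `t ∈ [a, b]`
(adapted from `Torus.IsClassicalNSSolutionOn.integral_norm_sub_sq_le_mul_exp`; Temam 1979, Ch. III
§3.4: exponential stability of small steady flows). [folklore] -/
theorem integral_norm_sub_sq_le_mul_exp_neg (hν : 0 ≤ ν)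
    (hC : ∀ u w : UnitAddTorus (Fin 3) → EuclideanSpace ℝ (Fin 3), IsSmooth u → IsDivFree u →
      HasZeroMean u → IsSmooth w →
        |∫ x, ⟪convect u u x, w x⟫_ℝ| ≤ C * gradNormSq u * Real.sqrt (gradNormSq w))
    (h₁ : IsClassicalNSSolutionOn (Icc a b) ν f u₁ p₁)
    (h₂ : IsClassicalNSSolutionOn (Icc a b) ν f u₂ p₂) (hab : a < b)
    (h0 : ∀ t ∈ Icc a b, HasZeroMean (fun y => u₁ t y - u₂ t y))
    (hsm : ∀ t ∈ Icc a b, C * Real.sqrt (gradNormSq (u₂ t)) ≤ ν / 2) {t : ℝ} (ht : t ∈ Icc a b) :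
    ∫ x, ‖u₁ t x - u₂ t x‖ ^ 2 ≤
      (∫ x, ‖u₁ a x - u₂ a x‖ ^ 2) * Real.exp (-(4 * Real.pi ^ 2 * ν) * (t - a)) := by
  -- adapted from Literature/Analysis/FunctionSpaces/TorusClassicalNSUniqueness.lean
  -- (`IsClassicalNSSolutionOn.integral_norm_sub_sq_le_mul_exp`)
  classical
  set E : ℝ → ℝ := fun s => ∫ x, ⟪u₁ s x - u₂ s x, u₁ s x - u₂ s x⟫_ℝ with hE_def
  set E' : ℝ → ℝ := fun s => ∫ x, Torus.timeDerivWithin (Icc a b)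
    (fun σ y => ⟪u₁ σ y - u₂ σ y, u₁ σ y - u₂ σ y⟫_ℝ) s x with hE'_def
  have hE : ∀ s ∈ Icc a b, HasDerivWithinAt E (E' s) (Icc a b) s ∧
      E' s ≤ -(4 * Real.pi ^ 2 * ν) * E s := fun s hs =>
    energy_deriv_sub_le_neg hν hC h₁ h₂ hab h0 hsm hs
  have hEc : ContinuousOn E (Icc a b) := fun s hs => (hE s hs).1.continuousWithinAt
  have hder : ∀ s ∈ Ico a b, HasDerivWithinAt E (E' s) (Ici s) s := fun s hs =>
    ((hE s (Ico_subset_Icc_self hs)).1.mono (Icc_subset_Icc hs.1 le_rfl)).mono_of_mem_nhdsWithin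
      (Icc_mem_nhdsGE hs.2)
  have hgr := le_gronwallBound_of_liminf_deriv_right_le (f := E) (f' := E') (δ := E a)
    (K := -(4 * Real.pi ^ 2 * ν)) (ε := 0) (a := a) (b := b) hEc
    (fun s hs r hr => (hder s hs).liminf_right_slope_le hr) le_rfl
    (fun s hs => by
      rw [add_zero]
      exact (hE s (Ico_subset_Icc_self hs)).2) t ht
  rw [gronwallBound_ε0] at hgr
  have hEeq : ∀ s, E s = ∫ x, ‖u₁ s x - u₂ s x‖ ^ 2 := fun s => by
    simp only [hE_def, real_inner_self_eq_norm_sq]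
  rw [hEeq, hEeq] at hgr
  exact hgr

end Energy

/-! ## §2 The stub -/

/-- **stub_periodicIsSteady** (registered stub of the line `malkin-cone-group-orbits`, companion c1).
PERIODIC SOLUTIONS NEAR THE LAMINAR REGIME ARE STEADY: there is `κ > 0` such that a `τ`-periodic
classical solution `u` of `NS_ν(f)` on `ℝ × T³` and a classical steady state `v` of the same system
with the same spatial mean (`∫ u(t) = ∫ v` for all `t`) and `‖∇v‖₂ ≤ κ ν` coincide: with `C` the
trilinear constant of `SmallData.exists_abs_trilinear_le` and `κ = 1/(2C+2)` (so `C‖∇v‖₂ ≤ ν/2`),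
`w = u - v` satisfies `d/dt ∫‖w‖² ≤ -4π²ν∫‖w‖²` on every `[t, t + τ]` (`energy_deriv_sub_le_neg`, the
steady state viewed as a constant-in-time classical solution, `IsClassicalNSSolutionOn.mono`), so
`∫‖w(t+τ)‖² ≤ e^{-4π²ντ}∫‖w(t)‖²`; periodicity gives `∫‖w(t)‖²(1 - e^{-4π²ντ}) ≤ 0`, whence
`w(t) = 0`.  (Serrin 1959 / Temam 1979 Ch. III §3.4: uniqueness and stability of small steady flows,
eternal version.) [folklore] -/
theorem stub_periodicIsSteady : ∃ κ : ℝ, 0 < κ ∧ ∀ (ν τ : ℝ) (f : UnitAddTorus (Fin 3) → EuclideanSpace ℝ (Fin 3)) (u : ℝ → UnitAddTorus (Fin 3) → EuclideanSpace ℝ (Fin 3)) (p : ℝ → UnitAddTorus (Fin 3) → ℝ) (v : UnitAddTorus (Fin 3) → EuclideanSpace ℝ (Fin 3)) (q : UnitAddTorus (Fin 3) → ℝ), 0 < ν → 0 < τ → IsClassicalNSSolutionOn Set.univ ν (fun _ => f) u p → Function.Periodic u τ → Torus.IsSteadyNSState ν f v q → (∀ t, (∫ x, u t x) = (∫ x,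 v x)) → Real.sqrt (gradNormSq v) ≤ κ * ν → ∀ t, u t = v := by
  obtain ⟨C, hC0, hC⟩ := SmallData.exists_abs_trilinear_le
  refine ⟨1 / (2 * C + 2), by positivity, ?_⟩
  intro ν τ f u p v q hν hτ hsol hper hst hmean hsmall t
  -- restrict both solutions to the compact interval `[t, t + τ]`
  have hab : t < t + τ := by linarith
  have hU : UniqueDiffOn ℝ (Icc t (t + τ)) := uniqueDiffOn_Icc hab
  have h₁ : IsClassicalNSSolutionOn (Icc t (t + τ)) ν (fun _ => f) u p :=
    hsol.mono (subset_univ _) hU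
  have h₂ : IsClassicalNSSolutionOn (Icc t (t + τ)) ν (fun _ => f) (fun _ => v) (fun _ => q) :=
    hst.mono (subset_univ _) hU
  have hv : IsSmooth v := hst.smooth_velocity.isSmooth_slice (Set.mem_univ (0 : ℝ))
  -- the difference has zero mean at all times
  have h0 : ∀ s ∈ Icc t (t + τ), HasZeroMean (fun y => u s y - (fun _ : ℝ => v) s y) := by
    intro s hs
    have hus : IsSmooth (u s) := h₁.smooth_velocity.isSmooth_slice hs
    show ∫ y, (u s y - v y) = 0
    rw [integral_sub hus.integrable hv.integrable, hmean s, sub_self]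
  -- smallness: `C‖∇v‖₂ ≤ ν/2`
  have hsm : ∀ s ∈ Icc t (t + τ), C * Real.sqrt (gradNormSq ((fun _ : ℝ => v) s)) ≤ ν / 2 := by
    intro s _
    show C * Real.sqrt (gradNormSq v) ≤ ν / 2
    have h1 : C * Real.sqrt (gradNormSq v) ≤ C * (1 / (2 * C + 2) * ν) :=
      mul_le_mul_of_nonneg_left hsmall hC0
    have h2 : C * (1 / (2 * C + 2) * ν) ≤ ν / 2 := by
      rw [show C * (1 / (2 * C + 2) * ν) = C * ν / (2 * C + 2) by ring,
        div_le_div_iff₀ (by positivity) (by positivity)]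
      nlinarith
    exact h1.trans h2
  -- exponential decay over one period, and periodicity
  have hg := integral_norm_sub_sq_le_mul_exp_neg hν.le hC h₁ h₂ hab h0 hsm ⟨hab.le, le_rfl⟩
  have hperiod : u (t + τ) = u t := hper t
  simp only [hperiod, add_sub_cancel_left] at hg
  set X : ℝ := ∫ x, ‖u t x - v x‖ ^ 2 with hX
  have hX0 : 0 ≤ X := integral_nonneg fun _ => sq_nonneg _
  have hexp : Real.exp (-(4 * Real.pi ^ 2 * ν) * τ) < 1 := by
    rw [Real.exp_lt_one_iff]
    have : 0 < 4 * Real.pi ^ 2 * ν * τ := by positivity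
    linarith
  have hXle : X ≤ 0 := by
    by_contra hpos
    push Not at hpos
    have : X * Real.exp (-(4 * Real.pi ^ 2 * ν) * τ) < X * 1 := mul_lt_mul_of_pos_left hexp hpos
    linarith
  have hw : IsSmooth (u t - v) := (h₁.smooth_velocity.isSmooth_slice ⟨le_rfl, hab.le⟩).sub hv
  exact sub_eq_zero.1 (eq_zero_of_integral_norm_sq_nonpos hw hXle)

end Summit.AnomalousDissipation.AnomalousDissipation.Theorems.RobustLoudUpgrade.LaminarCorner

end
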